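import Summits.NavierStokesRegularity.NavierStokesRegularity.Cruxes.BoundedTemperatureClosed.SketchIdeator4
import Summits.NavierStokesRegularity.NavierStokesRegularity.Theorems.PumpContinuationBoundedTemperatureClosedSchwartzData
import Summits.NavierStokesRegularity.NavierStokesRegularity.Theorems.PumpContinuationBoundedTemperatureClosedDenseMeetsFiniteCodim

/-!
# Line `SketchIdeator4` for `BoundedTemperatureClosed` (stmt-NavierStokesRegularity-18303) — lead a1's skeleton

Composition (ideator k = 4, cards `gkp-critical-temperature` + `signed-terminal-descent`; transfer
`IdeasK4.crux_of_relaxedH10` PROVED in the Sketch): the crux BY NAME from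

* `stub_schwartzSubH10` — complexified divergence-free Schwartz fields are `H¹⁰_df` data (tree-grade);
* `stub_relaxedClosedH10 : RelaxedClosedIn h10Data` — the crux with Schwartz data RELAXED to all of
  `H¹⁰_df` (closedness in `θ` of the bounded-temperature blow-up sets over `H¹⁰_df` data, every symmetric
  cancelling `𝒜`, every ceiling `M`). WARNING (lead a1, kernel-checked in `Lines/SketchIdeator4Checks.lean`):
  this stub is CRUX-SIZED — it is stronger than the crux for general `𝒜`, and at the zero averaging datum it
  is exactly "the set of Type-I ceilings of `H¹⁰_df`-data `H¹⁰_df`-mild Navier–Stokes blow-ups is closed"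
  (attainment of the infimal Type-I constant over `H¹⁰_df` data), the `H¹⁰_df` twin of the registered open
  statement `¬ TypeIInfimumNotAttainedNS` that killed line `Sketch` (Sketch-dead O1);
* `stub_denseMeetsFiniteCodim` — a dense linear subspace of a Banach space meets the zero set of a `C¹`
  submersion to `ℝᵏ` arbitrarily close to any of its zeros (pure functional analysis; the card's brick for
  putting SCHWARTZ data on a finite-codimension manifold of relaxed minimisers);
* `stub_saturationOfDense : DenseMeetsFiniteCodim → SchwartzSaturationIn h10Data` — Schwartz saturation:
  every `H¹⁰_df`-datum bounded-temperature blow-up of a segment operator is matched by a Schwartz-datum one at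
  the SAME operator and ceiling. WARNING: at the Euler datum this is exact Schwartz re-entry of Navier–Stokes
  Type-I blow-ups at every ceiling (no `η`-loss); jointly with `stub_relaxedClosedH10` it proves the crux and
  hence `¬ TypeIInfimumNotAttainedNS` (p146867/p148254).
-/

noncomputable section

open MeasureTheory Set Filter Topology Function
open scoped ENNReal
open Literature.Analysis.FluidPDE Literature.Analysis.FluidPDE.Tao2016
open Summit.NavierStokesRegularity.NavierStokesRegularity.Cruxes.BoundedTemperatureClosed.IdeasK4

set_option linter.dupNamespace false

namespace Summit.NavierStokesRegularity.NavierStokesRegularity.Cruxes.BoundedTemperatureClosed.SketchIdeator4Line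

/-- Registered stub — LANDED (p161486, `Theorems/PumpContinuationBoundedTemperatureClosedSchwartzData.lean`,
worker wave cycle 1): complexified divergence-free Schwartz fields are `H¹⁰_df` data. -/
theorem stub_schwartzSubH10 :
    ∀ u₀ : SchwartzMap (EuclideanSpace ℝ (Fin 3)) (EuclideanSpace ℝ (Fin 3)),
      VectorCalculus.IsDivFree ⇑u₀ → MemH10df (schwartzL2 u₀) :=
  Theorems.PumpContinuationSchwartzData.stub_schwartzSubH10

/-- Registered stub (CRUX-SIZED, held by the lead): relaxed closedness over `H¹⁰_df` data. -/
theorem stub_relaxedClosedH10 : RelaxedClosedIn h10Data := by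
  sorry

/-- Registered stub — LANDED (p161715, `Theorems/PumpContinuationBoundedTemperatureClosedDenseMeetsFiniteCodim.lean`,
worker wave cycle 1): dense subspaces meet regular zero sets of `C¹` maps to `ℝᵏ` near every zero
(`ApproximatesLinearOn` surjectivity on a `k`-slice chosen inside the dense subspace). -/
theorem stub_denseMeetsFiniteCodim :
    ∀ (E : Type) [NormedAddCommGroup E] [NormedSpace ℝ E] [CompleteSpace E] (k : ℕ)
      (D : Submodule ℝ E), Dense (D : Set E) →
      ∀ (F : E → EuclideanSpace ℝ (Fin k)) (x₀ : E), ContDiff ℝ 1 F → F x₀ = 0 →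
        Function.Surjective (fderiv ℝ F x₀) →
        ∀ ε : ℝ, 0 < ε → ∃ d : E, d ∈ D ∧ dist d x₀ < ε ∧ F d = 0 :=
  Theorems.PumpContinuationDenseMeetsFiniteCodim.stub_denseMeetsFiniteCodim

/-- Registered stub (CRUX-GRADE at the Euler datum): Schwartz saturation of `H¹⁰_df`-data
bounded-temperature blow-ups, from the dense-meets-finite-codimension brick (card signed-terminal-descent:
signed first-order descent of the temperature on the blow-up manifold of a relaxed witness). -/
theorem stub_saturationOfDense : DenseMeetsFiniteCodim → SchwartzSaturationIn h10Data := by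
  sorry

/-- The data-class inclusion `schwartzData ⊆ h10Data` from the registered Schwartz stub. -/
theorem schwartzSubH10_of_stub
    (h : ∀ u₀ : SchwartzMap (EuclideanSpace ℝ (Fin 3)) (EuclideanSpace ℝ (Fin 3)),
      VectorCalculus.IsDivFree ⇑u₀ → MemH10df (schwartzL2 u₀)) : SchwartzSubH10 := by
  rintro a ⟨u₀, hdiv, rfl⟩
  exact h u₀ hdiv

/-- **Composition**: the crux BY NAME, modulo the registered stubs (`IdeasK4.crux_of_relaxedH10`). -/
theorem BoundedTemperatureClosed_of : Theses.PumpContinuation.BoundedTemperatureClosed :=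
  crux_of_relaxedH10 (schwartzSubH10_of_stub stub_schwartzSubH10) stub_relaxedClosedH10
    (stub_saturationOfDense stub_denseMeetsFiniteCodim)

end Summit.NavierStokesRegularity.NavierStokesRegularity.Cruxes.BoundedTemperatureClosed.SketchIdeator4Line

end
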